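import Literature.AlgebraicGeometry.Resolution.AlterationsNormalFormBlowup
import Literature.AlgebraicGeometry.Resolution.AlterationsNodeLocalStructure
import Literature.AlgebraicGeometry.Resolution.StrictNormalCrossingsAt
import HarnessLib

/-!
# De Jong 1997, proof of Prop. 5.11: the equivariant normal form of a pair (Situation 4.25 of
# de Jong 1996 over an arbitrary ground field, with `G`-orbits of singular components)

Topic: `Literature/AlgebraicGeometry/Resolution`. Companion to `AlterationsNormalForm.lean`
(`DeJong1996.NormalFormPair`: de Jong 1996, Situation 4.25, over an ALGEBRAICALLY CLOSED field,
one component of `Sing(X)` blown up at a time). De Jong 1997 runs the same induction (4.26–4.28)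
`G`-EQUIVARIANTLY and over an ARBITRARY regular excellent base; for the total space `X` of a
quasi-split `G`-semi-stable curve over a regular projective `G`-variety this is the proof of his
Prop. 5.11:

> "Thus we may assume that `X → S` is quasi-split semi-stable and `codim(Sing(X), X) ≥ 3`. The
> rest of our argument is similar to the arguments of [1, 4.24–4.28] and [1, 7.16]. The types of
> complete local rings that we have now are `A⟦u, v⟧/(uv - t₁ ⋯ t_s)`, where `A` is a regular
> complete local ring with a regular system of parameters `t₁, …, t_{d-1}`, and `D` is given by
> `t₁ ⋯ t_r = 0`, for some `1 ≤ s ≤ r ≤ d - 1`. We give the argument that proves that the blow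
> ups that occur in the proof of [1, 4.26 and 4.27] can be made `G`-equivariantly. Indeed, by
> the remarks at the end of [1, 3.5] we have `Sing(X) = ⋃ E_α`, with `E_α` regular … Thus, as
> `D` is `G`-strict, we have that `⋃_{g ∈ G} g(E_α)` is a disjoint union of components `E_β`.
> Thus the last sentence of [1, 4.25] should be replaced with: Any `G`-orbit of a component of
> the singular locus of `X` is nonsingular. Thus we blow up in orbits of components of the
> singular locus of `X`. The resulting scheme has a local description as above by the
> computations of [1, 4.27]. Hence we arrive at a regular scheme `X'` with an action of `G` and
> a `G`-stable normal crossings divisor `D' ⊂ X'`." (de Jong 1997, p. 619)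

This file DEFINES that invariant of the equivariant iteration, `DeJong1997.QuasiSplitNormalFormPair
f Z ρ d` — de Jong 1996, Situation 4.25 for the pair `(X, Z)` with an action `ρ : G →* Aut X`,
with exactly the two changes the quotation prescribes:

* the formal models carry NO coefficient field. At a singular closed point 4.25 (ii) reads
  `𝒪̂_{X,x} ≅ A⟦u, v⟧/(uv - t₁ ⋯ t_s)` for SOME regular local ring `A` of dimension `d - 1` with
  regular system of parameters `t₁, …, t_{d-1}` (the tree's `DeJong1996.NodeDeformationRing A h =
  A⟦u, v⟧/(uv - h)` of 2.23), the completed ideal of `Z` being `(t₁ ⋯ t_r)`, `2 ≤ s ≤ r ≤ d - 1`;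
  at a regular closed point of `Z` 4.25 (i) reads: the completed ideal of `Z` in `𝒪̂_{X,x}` has
  local strict normal crossings data (`IsSNCIdeal`: `𝒪̂_{X,x}` regular, `Î_Z = (x₁ ⋯ x_r)` for
  part `x₁, …, x_r`, `r ≥ 1`, of a regular system of parameters). Over an algebraically closed
  `k` at a closed point, `A ≅ k⟦t₁, …, t_{d-1}⟧` (Cohen) and these are the two conditions of
  `DeJong1996.NormalFormPair` (`NodalFamilyRing k (d - 1) s`, `normalCrossingsEquation k d r`); in
  general the residue field of `x` is a finite extension of `k` that need not lift into `𝒪̂_{X,x}`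
  compatibly with `k` (inseparability), whence the coefficient-free rendering — which is also the
  shape in which 2.23/3.3 deliver the complete local rings (`DeJong1996NodeLocalStructure`:
  `A = 𝒪̂_{Y, f x}`) and which is stable under the finite residue field extensions met at the
  closed points of a blow-up;
* "the components of the singular locus of `X` are nonsingular" becomes "any `G`-orbit of a
  component of the singular locus of `X` is nonsingular": for every irreducible component `E` of
  `Sing(X) = {x | 𝒪_{X,x} not regular}` the reduced closed subscheme on the closure of
  `⋃_g ρ(g)(E)` is a regular scheme (so distinct translates of `E` are disjoint, a regular local
  ring being a domain). For the trivial action this is the condition of 4.25.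

As in `DeJong1996.NormalFormPair` the conditions are imposed at CLOSED points (`X` is Jacobson)
on Mathlib's `AdicCompletion` of `𝒪_{X,x}` at its maximal ideal, `Z` is closed and the support
of an effective Cartier divisor (2.3), `X` is integral, projective over `k`, of dimension `d`,
and the singular locus is closed. Nothing relates `ρ` to `f` or `Z` (the iteration only needs
the orbits of singular components, which are `ρ`-stable by construction).

Proved here (sorry-free): the structural consequences `isProper`, `isSeparated`,
`locallyOfFiniteType`, `quasiCompact`, `isNoetherian`, `jacobsonSpace`, `ne_univ`,
`finite_irreducibleComponents` (the measure of the iteration is finite); the end of the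
iteration, which needs no chart computation: `isRegular_of_irreducibleComponents_eq_empty` (no
singular component ⇒ `X` regular) and its converse; and the bookkeeping of the orbit centres:
`closure_orbit_subset` (an orbit closure lies in the singular locus), `vanishingIdeal_orbit_ne_bot`
(its reduced ideal sheaf is a non-zero blow-up centre), `preimage_closure_orbit` (it is
`ρ`-stable, so the action lifts to its blow-up). NOT here (the named facts of the equivariant
4.27 and of the entry 3.5, to be vendored or proved by their users): the orbit version of
Claim 4.27, the formal/étale comparison of normal crossings at the regular points (de Jong 1996,
4.28 with 2.4), and 3.5 for quasi-split semi-stable curves (whence the name).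

## Sources

* A. J. de Jong, *Families of curves and alterations*, Ann. Inst. Fourier 47 (1997) 599–621:
  Prop. 5.11 and its proof, pp. 618–619. [DeJong1997]
* A. J. de Jong, *Smoothness, semi-stability and alterations*, Publ. Math. IHÉS 83 (1996) 51–93:
  2.23 (pp. 61–62), 3.5 (p. 64), 4.25–4.28 (pp. 75–76). [DeJong1996]
-/

noncomputable section

open CategoryTheory CategoryTheory.Limits AlgebraicGeometry TopologicalSpace Topology

namespace Literature.AlgebraicGeometry.Resolution

universe u v

open IsLocalRing

namespace DeJong1997

open Scheme.IdealSheafData in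
/-- **De Jong 1997, proof of Prop. 5.11 (= de Jong 1996, Situation 4.25, equivariant and without
coefficient field)** for the pair `(X, Z)` with the action `ρ : G →* Aut X`: "The types of
complete local rings that we have now are `A⟦u, v⟧/(uv - t₁ ⋯ t_s)`, where `A` is a regular
complete local ring with a regular system of parameters `t₁, …, t_{d-1}`, and `D` is given by
`t₁ ⋯ t_r = 0`, for some `1 ≤ s ≤ r ≤ d - 1`. … Thus the last sentence of [1, 4.25] should be
replaced with: Any `G`-orbit of a component of the singular locus of `X` is nonsingular."
Rendered: `X` integral, projective over the field `k`, `dim X = d`; `Z` closed, the support of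
an effective Cartier divisor (de Jong 1996, 2.3); for every CLOSED point `x`: (i) if `𝒪_{X,x}`
is regular and `x ∈ Z`, the completed ideal of (the reduced structure on) `Z` in `𝒪̂_{X,x}`
(`completedStalkIdeal`, any affine open `U ∋ x`) has local strict normal crossings data
(`IsSNCIdeal`; the case `s = 1` of the quotation, and 4.25 (i)); (ii) if `𝒪_{X,x}` is not
regular, there are a regular local ring `A` of dimension `d - 1`, a regular system of
parameters `t : Fin (d - 1) → A`, integers `2 ≤ s ≤ r ≤ d - 1` and a ring isomorphism
`𝒪̂_{X,x} ≅ A⟦u, v⟧/(uv - ∏_{i<s} tᵢ)` (`DeJong1996.NodeDeformationRing`) carrying the completed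
ideal of `Z` to `(∏_{i<r} tᵢ)` (4.25 (ii), `s ≥ 2` at a singular point); the singular locus
`{x | 𝒪_{X,x} not regular}` is closed; and for every irreducible component `E` of it the
reduced closed subscheme on the closure of the orbit `⋃_g ρ(g)(E)` is a regular scheme.
[cite: DeJong1997, proof of Prop. 5.11, p. 619] -/
structure QuasiSplitNormalFormPair {k : Type u} [Field k] {X : Scheme.{u}} (f : X ⟶ Spec (.of k))
    (Z : Set X) {G : Type v} [Group G] (ρ : G →* Aut X) (d : ℕ) : Prop where
  /-- `X` is integral -/
  isIntegral : IsIntegral X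
  /-- `X` is projective over `k` -/
  isProjectiveOver : Literature.AlgebraicGeometry.Motives.IsProjectiveOver (Over.mk f)
  /-- `dim X = d` -/
  topologicalKrullDim_eq : topologicalKrullDim X = d
  /-- `Z` is closed -/
  isClosed : IsClosed Z
  /-- `Z` is (the support of) an effective Cartier divisor (de Jong 1996, 2.3) -/
  exists_isEffectiveCartier :
    ∃ I : X.IdealSheafData, IsEffectiveCartier I ∧ (I.support : Set X) = Z
  /-- (i) at a regular closed point of `Z`, the completed ideal of `Z` has local strict normal
  crossings data in `𝒪̂_{X,x}` ("`Z` is a normal crossings divisor at `x`", formally) -/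
  isSNCIdeal_completedStalkIdeal : ∀ x : X, IsClosed ({x} : Set X) →
    ∀ [IsRegularLocalRing (X.presheaf.stalk x)], x ∈ Z →
      ∀ (U : X.affineOpens) (hU : x ∈ (U : X.Opens)),
        IsSNCIdeal (completedStalkIdeal (vanishingIdeal ⟨Z, isClosed⟩) x U hU)
  /-- (ii) at a singular closed point, `(𝒪̂_{X,x}, Î_Z) ≅ (A⟦u, v⟧/(uv - t₁ ⋯ t_s), (t₁ ⋯ t_r))`
  for a regular local ring `A` with regular system of parameters `t₁, …, t_{d-1}` and
  `2 ≤ s ≤ r ≤ d - 1` -/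
  exists_ringEquiv_of_not_isRegularLocalRing : ∀ x : X, IsClosed ({x} : Set X) →
    ¬ IsRegularLocalRing (X.presheaf.stalk x) →
      ∃ (A : Type u) (_ : CommRing A) (_ : IsRegularLocalRing A) (t : Fin (d - 1) → A) (s r : ℕ),
        Ideal.span (Set.range t) = maximalIdeal A ∧ ringKrullDim A = (d - 1 : ℕ) ∧
        2 ≤ s ∧ s ≤ r ∧ r ≤ d - 1 ∧
        ∃ e : AdicCompletion (maximalIdeal (X.presheaf.stalk x)) (X.presheaf.stalk x) ≃+*
            DeJong1996.NodeDeformationRing A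
              (∏ i ∈ Finset.univ.filter (fun i : Fin (d - 1) => i.val < s), t i),
          ∀ (U : X.affineOpens) (hU : x ∈ (U : X.Opens)),
            (completedStalkIdeal (vanishingIdeal ⟨Z, isClosed⟩) x U hU).map e.toRingHom =
              Ideal.span {DeJong1996.NodeDeformationRing.ofBase A _
                (∏ i ∈ Finset.univ.filter (fun i : Fin (d - 1) => i.val < r), t i)}
  /-- the singular locus of `X` is closed -/
  isClosed_setOf_not_isRegularLocalRing :
    IsClosed {x : X | ¬ IsRegularLocalRing (X.presheaf.stalk x)}
  /-- any `G`-orbit of an irreducible component of the singular locus of `X` (the reduced closed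
  subscheme on the closure of the union of its translates) is nonsingular -/
  isRegular_subscheme_orbit : ∀ E ∈ irreducibleComponents
      ↥({x : X | ¬ IsRegularLocalRing (X.presheaf.stalk x)} : Set X),
    Scheme.IsRegular
      (vanishingIdeal ⟨closure (⋃ g : G, (ρ g).hom.base '' (Subtype.val '' E)),
        isClosed_closure⟩).subscheme

namespace QuasiSplitNormalFormPair

variable {k : Type u} [Field k] {X : Scheme.{u}} {f : X ⟶ Spec (.of k)} {Z : Set X}
  {G : Type v} [Group G] {ρ : G →* Aut X} {d : ℕ}

/-- `X → Spec k` is proper. [folklore] -/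
theorem isProper (h : QuasiSplitNormalFormPair f Z ρ d) : IsProper f :=
  Literature.AlgebraicGeometry.Motives.IsProjectiveOver.isProper (X := Over.mk f)
    h.isProjectiveOver

/-- `X → Spec k` is separated. [folklore] -/
theorem isSeparated (h : QuasiSplitNormalFormPair f Z ρ d) : IsSeparated f :=
  haveI := h.isProper
  inferInstance

/-- `X → Spec k` is locally of finite type. [folklore] -/
theorem locallyOfFiniteType (h : QuasiSplitNormalFormPair f Z ρ d) : LocallyOfFiniteType f :=
  haveI := h.isProper
  inferInstance

/-- `X → Spec k` is quasi-compact. [folklore] -/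
theorem quasiCompact (h : QuasiSplitNormalFormPair f Z ρ d) : QuasiCompact f :=
  haveI := h.isProper
  inferInstance

/-- `X` is Noetherian. [folklore] -/
theorem isNoetherian (h : QuasiSplitNormalFormPair f Z ρ d) : IsNoetherian X :=
  DeJong1996.isNoetherian_of_isProjectiveOver f h.isProjectiveOver

/-- `X` is a Jacobson space (locally of finite type over a field): closed points are dense in
every closed subset, so conditions at closed points control `X`. [folklore] -/
theorem jacobsonSpace (h : QuasiSplitNormalFormPair f Z ρ d) : JacobsonSpace X :=
  haveI := h.locallyOfFiniteType
  LocallyOfFiniteType.jacobsonSpace f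

/-- `Z ≠ X` (the support of a divisor on a variety misses the generic point). [folklore] -/
theorem ne_univ (h : QuasiSplitNormalFormPair f Z ρ d) : Z ≠ Set.univ := by
  haveI := h.isIntegral
  obtain ⟨I, hI, hIZ⟩ := h.exists_isEffectiveCartier
  intro hZ
  have := DeJong1996.NormalProjectivePair.genericPoint_notMem_support hI
  rw [hIZ, hZ] at this
  exact this (Set.mem_univ _)

/-- The number of irreducible components of the singular locus (the measure of the iteration
4.26–4.28) is finite. [folklore] -/
theorem finite_irreducibleComponents (h : QuasiSplitNormalFormPair f Z ρ d) :
    (irreducibleComponents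
      ↥({x : X | ¬ IsRegularLocalRing (X.presheaf.stalk x)} : Set X)).Finite :=
  haveI := h.isNoetherian
  NoetherianSpace.finite_irreducibleComponents

/-- **The end of the iteration** (de Jong 1996, 4.28: "we finally get the situation that `X` is
nonsingular"): without singular components `X` is regular — every point of a topological space
lies in an irreducible component. [cite: DeJong1996, 4.28, p. 76] -/
theorem isRegular_of_irreducibleComponents_eq_empty (_h : QuasiSplitNormalFormPair f Z ρ d)
    (h0 : irreducibleComponents
      ↥({x : X | ¬ IsRegularLocalRing (X.presheaf.stalk x)} : Set X) = ∅) :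
    Scheme.IsRegular X := by
  intro x
  by_contra hx
  have hmem := irreducibleComponent_mem_irreducibleComponents
    (⟨x, hx⟩ : ↥({x : X | ¬ IsRegularLocalRing (X.presheaf.stalk x)} : Set X))
  rw [h0] at hmem
  exact hmem

/-- Conversely, a regular `X` has no singular component. [folklore] -/
theorem irreducibleComponents_eq_empty_of_isRegular (_h : QuasiSplitNormalFormPair f Z ρ d)
    (hreg : Scheme.IsRegular X) :
    irreducibleComponents
      ↥({x : X | ¬ IsRegularLocalRing (X.presheaf.stalk x)} : Set X) = ∅ := by
  have hempty : IsEmpty ↥({x : X | ¬ IsRegularLocalRing (X.presheaf.stalk x)} : Set X) :=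
    ⟨fun x => x.2 (hreg x.1)⟩
  ext E
  simp only [Set.mem_empty_iff_false, iff_false]
  intro hE
  obtain ⟨x, -⟩ := (hE.1).1
  exact hempty.elim x

/-! ### The orbit centres -/

/-- The closure of the orbit `⋃_g ρ(g)(E)` of a subset `E` of the singular locus lies in the
singular locus (which is closed and stable under automorphisms). [folklore] -/
theorem closure_orbit_subset (h : QuasiSplitNormalFormPair f Z ρ d)
    (E : Set ↥({x : X | ¬ IsRegularLocalRing (X.presheaf.stalk x)} : Set X)) :
    closure (⋃ g : G, (ρ g).hom.base '' (Subtype.val '' E)) ⊆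
      {x : X | ¬ IsRegularLocalRing (X.presheaf.stalk x)} := by
  refine closure_minimal (Set.iUnion_subset fun g => ?_) h.isClosed_setOf_not_isRegularLocalRing
  rintro _ ⟨_, ⟨x, -, rfl⟩, rfl⟩ hreg
  apply x.2
  have i := (asIso ((ρ g).hom.stalkMap x.1)).commRingCatIsoToRingEquiv
  haveI : IsRegularLocalRing (X.presheaf.stalk ((ρ g).hom.base x.1)) := hreg
  exact IsRegularLocalRing.of_ringEquiv i

/-- The closure of an orbit of a subset of the singular locus is a proper closed subset of the
variety `X` (it misses the generic point, whose local ring is the function field), so its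
reduced ideal sheaf — the centre blown up in the iteration — is non-zero. [folklore] -/
theorem vanishingIdeal_orbit_ne_bot (h : QuasiSplitNormalFormPair f Z ρ d)
    (E : Set ↥({x : X | ¬ IsRegularLocalRing (X.presheaf.stalk x)} : Set X)) :
    Scheme.IdealSheafData.vanishingIdeal
        ⟨closure (⋃ g : G, (ρ g).hom.base '' (Subtype.val '' E)), isClosed_closure⟩ ≠ ⊥ := by
  haveI := h.isIntegral
  intro hbot
  have hsupp : (closure (⋃ g : G, (ρ g).hom.base '' (Subtype.val '' E)) : Set X) = Set.univ := by
    have := congrArg (fun I : X.IdealSheafData => ((I.support : Closeds X) : Set X)) hbot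
    simpa [Scheme.IdealSheafData.coe_support_vanishingIdeal,
      Scheme.IdealSheafData.support_bot] using this
  have hη : genericPoint X ∈ closure (⋃ g : G, (ρ g).hom.base '' (Subtype.val '' E)) := by
    rw [hsupp]
    trivial
  exact DeJong1996.NormalFormPair.genericPoint_notMem_singularLocus X (h.closure_orbit_subset E hη)

/-- The closure of an orbit is stable under the action: `ρ(g)⁻¹` of it is itself (so its reduced
ideal sheaf is `ρ`-stable and the action lifts to the blow-up). [folklore] -/
theorem preimage_closure_orbit (_h : QuasiSplitNormalFormPair f Z ρ d) (E : Set X) (g : G) :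
    (ρ g).hom.base ⁻¹' closure (⋃ g : G, (ρ g).hom.base '' E) =
      closure (⋃ g : G, (ρ g).hom.base '' E) := by
  -- `ρ g` is a homeomorphism permuting the translates of `E`
  have key : ∀ g : G, (ρ g).hom.base '' (⋃ g' : G, (ρ g').hom.base '' E) ⊆
      ⋃ g' : G, (ρ g').hom.base '' E := fun g => by
    rw [Set.image_iUnion]
    refine Set.iUnion_subset fun g' => ?_
    rw [Set.image_image]
    refine (Set.subset_iUnion (fun g' : G => (ρ g').hom.base '' E) (g * g')).trans_eq' ?_
    rw [map_mul]
    rfl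
  have heq : ∀ g : G, (ρ g).hom.base ⁻¹' (⋃ g' : G, (ρ g').hom.base '' E) =
      ⋃ g' : G, (ρ g').hom.base '' E := fun g => by
    refine Set.Subset.antisymm (fun x hx => ?_) (fun x hx => key g ⟨x, hx, rfl⟩)
    have hx' : (ρ g⁻¹).hom.base ((ρ g).hom.base x) ∈ ⋃ g' : G, (ρ g').hom.base '' E :=
      key g⁻¹ ⟨_, hx, rfl⟩
    have hid : (ρ g⁻¹).hom.base ((ρ g).hom.base x) = x := by
      have e1 : (ρ g⁻¹).hom = (ρ g).inv := by
        rw [map_inv, CategoryTheory.Aut.Aut_inv_def]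
        rfl
      rw [e1]
      simp
    rwa [hid] at hx'
  let φ := Scheme.homeoOfIso (ρ g)
  change φ ⁻¹' closure _ = _
  rw [φ.preimage_closure]
  exact congrArg closure (heq g)

end QuasiSplitNormalFormPair

end DeJong1997

end Literature.AlgebraicGeometry.Resolution

end
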